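import Summits.Ventures.Crystal3D.Theorems.StickyWulffConstantPolycrystalWulffBoundFreeEnergyExterior
import Summits.Ventures.Crystal3D.Theorems.StickyWulffConstantPolycrystalWulffBoundFacetAreaSymm

/-!
# `PolycrystalWulffBound`, rung `rung_basalLamellar` — step 2i: the adjacency sum of an arrangement
# package IS the free energy (line `PolyDensity`, crux `stmt-Ventures-19482`)

Route `StickyWulffConstant` of the venture `Summits/Ventures/Crystal3D`, second prover lane (poly-p2,
gen 3).  For an abstract arrangement package of a texture (cells, antisymmetric normals, grain index
sets `S f` with `G f =ᵐ ⋃_{S f} Q`, a container `A`, adjacency pairs `Adj` with exterior constraints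
`q₀` sharing the FULL FACE, and vanishing facet areas for non-adjacent grain/exterior pairs), the sum
consumed by `volume_chimera_le_of_package`,
`Σ_{(a,b) ∈ Adj} h_{K_{gr a}}(−q₀.1) · facetArea(cl Q_b ∩ plane q₀)(q₀.1)`, equals the crux's FREE
ENERGY `Σ_f [per K_f (G f) − Σ_{g ≠ f} ι_{K_f}(G f, G g)]` (`adjSum_eq_freeEnergy_of_package`):
the exterior clause of g2's exterior calculus (`two_mul_per_eq_crossSum_compl`) splits into adjacent
pairs (= twice the package term, by the full-face identity, `ν = ±q₀.1`, `facetArea_neg`, symmetric `K`)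
and non-adjacent pairs (zero).
WHAT THIS IS NOT: any measure estimate; nothing on the crux beyond bookkeeping.
-/

noncomputable section

namespace Summit.Ventures.Crystal3D.Theorems

open MeasureTheory Set
open scoped RealInnerProductSpace ENNReal Pointwise
open Summit.Ventures.Crystal3D.Cruxes.TextureLiminf.TexShadow

/-- The support function of an origin-symmetric body is even. -/
theorem supportFn_neg_of_neg_eq {K : Set E3} (hKs : -K = K) (v : E3) :
    supportFn K (-v) = supportFn K v := by
  unfold supportFn
  congr 1
  ext t
  simp only [mem_image]
  constructor
  · rintro ⟨y, hy, rfl⟩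
    refine ⟨-y, ?_, by rw [inner_neg_left, inner_neg_right]⟩
    rw [← hKs]; exact Set.neg_mem_neg.2 hy
  · rintro ⟨y, hy, rfl⟩
    refine ⟨-y, ?_, by rw [inner_neg_left, inner_neg_right, neg_neg]⟩
    rw [← hKs]; exact Set.neg_mem_neg.2 hy

/-- **The adjacency sum of a package is the free energy.**  See the module docstring. -/
theorem adjSum_eq_freeEnergy_of_package {n k : ℕ} (G : Fin n → Set E3)
    (H : Fin k → Finset (E3 × ℝ)) (ν : Fin k → Fin k → E3)
    (hbd : ∀ j, Bornology.IsBounded (polytope (H j)))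
    (hunit : ∀ j, ∀ q ∈ H j, ‖q.1‖ = 1)
    (hdist : ∀ j, ∀ q ∈ H j, ∀ q' ∈ H j, q ≠ q' → {x : E3 | ⟪q.1, x⟫ = q.2} ≠ {x : E3 | ⟪q'.1, x⟫ = q'.2})
    (hdisj : ∀ j j', j ≠ j' → Disjoint (polytope (H j)) (polytope (H j')))
    (hanti : ∀ i j, ν j i = -ν i j)
    (hplane : ∀ j j', j ≠ j' → ‖ν j j'‖ = 1 ∧ ∃ b' : ℝ,
      closure (polytope (H j)) ∩ closure (polytope (H j')) ⊆ {x : E3 | ⟪ν j j', x⟫ = b'})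
    {A : Set E3} (hAm : MeasurableSet A) (hAae : A =ᵐ[volume] ⋃ j, polytope (H j))
    (hAfin : ∀ K : Set E3, IsCompact K → Convex ℝ K → (0 : E3) ∈ K → perK K A ≠ ⊤)
    (S : Fin n → Finset (Fin k)) (hSdisj : ∀ f g, f ≠ g → Disjoint (S f) (S g))
    (hGS : ∀ f, G f =ᵐ[volume] ⋃ j ∈ S f, polytope (H j))
    (hcl : ∀ f, closure (⋃ j ∈ S f, polytope (H j)) ⊆ interior A)
    (gr : Fin k → Fin n) (hgrS : ∀ f, ∀ j ∈ S f, gr j = f)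
    (Adj : Finset (Fin k × Fin k)) (q₀ : Fin k × Fin k → E3 × ℝ)
    (hAdj : ∀ t ∈ Adj, t.1 ∈ S (gr t.1) ∧ (∀ g, t.2 ∉ S g) ∧ q₀ t ∈ H t.2 ∧
      closure (polytope (H t.1)) ∩ closure (polytope (H t.2)) =
        closure (polytope (H t.2)) ∩ {x : E3 | ⟪(q₀ t).1, x⟫ = (q₀ t).2} ∧
      (ν t.1 t.2 = (q₀ t).1 ∨ ν t.1 t.2 = -(q₀ t).1))
    (hzero : ∀ f, ∀ a ∈ S f, ∀ b, (∀ g, b ∉ S g) → (a, b) ∉ Adj →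
      facetArea (closure (polytope (H a)) ∩ closure (polytope (H b))) (ν a b) = 0)
    (K : Fin n → Set E3) (hKc : ∀ f, IsCompact (K f)) (hKv : ∀ f, Convex ℝ (K f))
    (hK0 : ∀ f, (0 : E3) ∈ K f) (hKs : ∀ f, -K f = K f) :
    (∑ t ∈ Adj, supportFn (K (gr t.1)) (-(q₀ t).1) *
        facetArea (closure (polytope (H t.2)) ∩ {x : E3 | ⟪(q₀ t).1, x⟫ = (q₀ t).2}) (q₀ t).1) =
      ∑ f, (per (K f) (G f) - ∑ g, (if f = g then 0 else
        (per (K f) (G f) + per (K f) (G g) - per (K f) (G f ∪ G g)) / 2)) := by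
  classical
  -- the cross kernel and the exterior index set
  set X : Set E3 → Fin k → Fin k → ℝ := fun K' a b =>
    (if a < b then (supportFn K' (ν a b) + supportFn K' (-ν a b)) *
        facetArea (closure (polytope (H a)) ∩ closure (polytope (H b))) (ν a b)
      else (supportFn K' (ν b a) + supportFn K' (-ν b a)) *
        facetArea (closure (polytope (H b)) ∩ closure (polytope (H a))) (ν b a)) with hX
  set SE : Finset (Fin k) := Finset.univ.biUnion S with hSE
  set SX : Finset (Fin k) := Finset.univ \ SE with hSX
  have hSXmem : ∀ b, b ∈ SX ↔ ∀ g, b ∉ S g := by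
    intro b; simp [hSX, hSE]
  -- (1) the exterior clause: `2 · free_f = crossSum(S f, SX)` (as in `exists_exterior_crossSums`)
  have hcompl : ∀ f, Finset.univ \ S f = (Finset.univ.erase f).biUnion S ∪ SX := by
    intro f
    ext j
    rw [Finset.mem_sdiff, Finset.mem_union, Finset.mem_biUnion, hSX, Finset.mem_sdiff, hSE,
      Finset.mem_biUnion]
    constructor
    · rintro ⟨-, hj⟩
      by_cases h : ∃ g, j ∈ S g
      · obtain ⟨g, hg⟩ := h
        exact Or.inl ⟨g, Finset.mem_erase.2 ⟨fun hgf => hj (hgf ▸ hg), Finset.mem_univ g⟩, hg⟩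
      · exact Or.inr ⟨Finset.mem_univ j, fun ⟨g, _, hg⟩ => h ⟨g, hg⟩⟩
    · rintro (⟨g, hg, hjg⟩ | ⟨-, h⟩)
      · exact ⟨Finset.mem_univ j, fun hjf =>
          Finset.disjoint_left.1 (hSdisj g f (Finset.mem_erase.1 hg).1) hjg hjf⟩
      · exact ⟨Finset.mem_univ j, fun hjf => h ⟨f, Finset.mem_univ f, hjf⟩⟩
  have hdisjX : ∀ f, Disjoint ((Finset.univ.erase f).biUnion S) SX := by
    intro f
    rw [Finset.disjoint_left]
    intro j hj hjX
    obtain ⟨g, -, hg⟩ := Finset.mem_biUnion.1 hj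
    exact (Finset.mem_sdiff.1 hjX).2 (Finset.mem_biUnion.2 ⟨g, Finset.mem_univ g, hg⟩)
  have hpwd : ∀ s : Finset (Fin n), (↑s : Set (Fin n)).PairwiseDisjoint S :=
    fun s f _ g _ hfg => hSdisj f g hfg
  have hext : ∀ f, 2 * (per (K f) (G f) - ∑ g, (if f = g then 0 else
      (per (K f) (G f) + per (K f) (G g) - per (K f) (G f ∪ G g)) / 2)) =
      ∑ a ∈ S f, ∑ b ∈ SX, X (K f) a b := by
    intro f
    have hwalls : ∀ g, f ≠ g → per (K f) (G f) + per (K f) (G g) - per (K f) (G f ∪ G g) =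
        ∑ a ∈ S f, ∑ b ∈ S g, X (K f) a b := by
      intro g hfg
      have hw := per_add_per_sub_per_union_eq_crossSum_of_polytopeCalculus stub_polytopeCalculus
        (hKc f) (hKv f) (hK0 f) H ν hbd hdisj hplane (hSdisj f g hfg)
      rw [Finset.set_biUnion_union, ← per_congr_ae (K f) (hGS f), ← per_congr_ae (K f) (hGS g),
        ← per_congr_ae (K f) ((hGS f).union (hGS g))] at hw
      exact hw
    have h := two_mul_per_eq_crossSum_compl (hKc f) (hKv f) (hK0 f) (hKs f) H ν hbd hunit hdist hdisj
      hplane hAm hAae (hAfin (K f) (hKc f) (hKv f) (hK0 f)) (S f) (hcl f)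
    rw [← per_congr_ae (K f) (hGS f), hcompl f] at h
    change 2 * per (K f) (G f) = ∑ a ∈ S f, ∑ b ∈ (Finset.univ.erase f).biUnion S ∪ SX, X (K f) a b at h
    simp_rw [Finset.sum_union (hdisjX f), Finset.sum_biUnion (hpwd (Finset.univ.erase f))] at h
    rw [sum_ite_eq_sum_erase_div_two, mul_sub, h]
    have hrw : (∑ g ∈ Finset.univ.erase f, (per (K f) (G f) + per (K f) (G g) - per (K f) (G f ∪ G g))) =
        ∑ a ∈ S f, ∑ g ∈ Finset.univ.erase f, ∑ b ∈ S g, X (K f) a b := by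
      rw [Finset.sum_comm]
      refine Finset.sum_congr rfl fun g hg => ?_
      have hfg : f ≠ g := fun h => (Finset.mem_erase.1 hg).1 h.symm
      exact hwalls g hfg
    rw [hrw, Finset.sum_add_distrib]; ring
  -- (2) the cross kernel on grain/exterior pairs
  have hXval : ∀ f, ∀ a ∈ S f, ∀ b ∈ SX, X (K f) a b =
      if (a, b) ∈ Adj then 2 * (supportFn (K f) (-(q₀ (a, b)).1) *
        facetArea (closure (polytope (H b)) ∩ {x : E3 | ⟪(q₀ (a, b)).1, x⟫ = (q₀ (a, b)).2})
          (q₀ (a, b)).1) else 0 := by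
    intro f a ha b hb
    have hbext : ∀ g, b ∉ S g := (hSXmem b).1 hb
    have hab : a ≠ b := fun h => hbext f (h ▸ ha)
    by_cases hadj : (a, b) ∈ Adj
    · rw [if_pos hadj]
      obtain ⟨-, -, -, hface, hνq⟩ := hAdj (a, b) hadj
      simp only at hface hνq
      have hface' : closure (polytope (H b)) ∩ closure (polytope (H a)) =
          closure (polytope (H b)) ∩ {x : E3 | ⟪(q₀ (a, b)).1, x⟫ = (q₀ (a, b)).2} := by
        rw [Set.inter_comm]; exact hface
      have hsymm := supportFn_neg_of_neg_eq (hKs f)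
      simp only [hX]
      split_ifs with hlt
      · rw [hface]
        rcases hνq with h | h
        · rw [h, hsymm]; ring
        · rw [h, neg_neg, hsymm, facetArea_neg]; ring
      · rw [hface', hanti a b]
        rcases hνq with h | h
        · rw [h, neg_neg, hsymm, facetArea_neg]; ring
        · rw [h, neg_neg, hsymm]; ring
    · rw [if_neg hadj]
      have hz := hzero f a ha b hbext hadj
      have hz' : facetArea (closure (polytope (H b)) ∩ closure (polytope (H a))) (ν b a) = 0 := by
        rw [Set.inter_comm, hanti a b, facetArea_neg]; exact hz
      simp only [hX]
      split_ifs
      · rw [hz, mul_zero]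
      · rw [hz', mul_zero]
  -- (3) regroup the adjacency sum by grains
  have hAdjsplit : ∀ f, Adj.filter (fun t => gr t.1 = f) = (S f ×ˢ SX).filter (fun t => t ∈ Adj) := by
    intro f
    ext t
    simp only [Finset.mem_filter, Finset.mem_product]
    constructor
    · rintro ⟨ht, hgr⟩
      obtain ⟨h1, h2, -⟩ := hAdj t ht
      exact ⟨⟨hgr ▸ h1, (hSXmem t.2).2 h2⟩, ht⟩
    · rintro ⟨⟨h1, -⟩, ht⟩
      exact ⟨ht, hgrS f t.1 h1⟩
  have hsumf : ∀ f, ∑ t ∈ Adj.filter (fun t => gr t.1 = f), supportFn (K (gr t.1)) (-(q₀ t).1) *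
      facetArea (closure (polytope (H t.2)) ∩ {x : E3 | ⟪(q₀ t).1, x⟫ = (q₀ t).2}) (q₀ t).1 =
      (∑ a ∈ S f, ∑ b ∈ SX, X (K f) a b) / 2 := by
    intro f
    rw [Finset.sum_div, Finset.sum_congr rfl fun a ha => Finset.sum_div ..]
    rw [hAdjsplit f, Finset.sum_filter, Finset.sum_product]
    refine Finset.sum_congr rfl fun a ha => Finset.sum_congr rfl fun b hb => ?_
    rw [hXval f a ha b hb]
    by_cases hadj : (a, b) ∈ Adj
    · rw [if_pos hadj, if_pos hadj, hgrS f a ha]; ring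
    · rw [if_neg hadj, if_neg hadj]; simp
  have hpart : (∑ t ∈ Adj, supportFn (K (gr t.1)) (-(q₀ t).1) *
      facetArea (closure (polytope (H t.2)) ∩ {x : E3 | ⟪(q₀ t).1, x⟫ = (q₀ t).2}) (q₀ t).1) =
      ∑ f, ∑ t ∈ Adj.filter (fun t => gr t.1 = f), supportFn (K (gr t.1)) (-(q₀ t).1) *
        facetArea (closure (polytope (H t.2)) ∩ {x : E3 | ⟪(q₀ t).1, x⟫ = (q₀ t).2}) (q₀ t).1 := by
    rw [← Finset.sum_fiberwise_of_maps_to (s := Adj) (t := Finset.univ) (g := fun t => gr t.1)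
      (fun t _ => Finset.mem_univ _)]
  rw [hpart]
  refine Finset.sum_congr rfl fun f _ => ?_
  rw [hsumf f]
  have h := hext f
  linarith

end Summit.Ventures.Crystal3D.Theorems

end
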